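import Literature.NumberTheory.EllipticCurves.FunctionFieldPlaces
import Mathlib.FieldTheory.Finite.Basic
import Mathlib.RingTheory.AdjoinRoot
import Mathlib.RingTheory.Localization.Integer
import Mathlib.RingTheory.Polynomial.Content
import Mathlib.RingTheory.Finiteness.Cardinality
import Mathlib.LinearAlgebra.Dimension.Free
import Mathlib.Algebra.Polynomial.Reverse
import HarnessLib

/-!
# Places of a global function field: the fact `Place.finite_residueField` (Stichtenoth Prop. I.1.15)

Sibling proof file (D-0014) of `Literature.NumberTheory.EllipticCurves.FunctionFieldPlaces`,
discharging its named fact `Literature.NumberTheory.EllipticCurves.FunctionField.Place.finite_residueField` — "the residue field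
`O_v/m_v` of every place `v` of a global function field `F/𝔽_q(T)` is finite" — as
`Place.finite_residueField_holds`, sorry-free, following the cited source.

## Source

H. Stichtenoth, *Algebraic Function Fields and Codes*, GTM 254 (2nd ed. 2009), §1.1:
Def. 1.1.14 ("`F_P := 𝒪_P/P` is the residue class field of `P` … `deg P := [F_P : K]` is called
the degree of `P`") and

> **Proposition 1.1.15.** If `P` is a place of `F/K` and `0 ≠ x ∈ P` then
> `deg P ≤ [F : K(x)] < ∞`.

*Printed proof.* `[F : K(x)] < ∞` by Remark 1.1.2. It suffices to show that any
`z₁, …, z_n ∈ 𝒪_P` whose residue classes `z_i(P)` are linearly independent over `K` are linearly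
independent over `K(x)`: given a non-trivial relation `∑ φ_i(x) z_i = 0` with `φ_i(x) ∈ K(x)`,
w.l.o.g. the `φ_i` are polynomials in `x` not all divisible by `x`, i.e. `φ_i(x) = a_i + x g_i(x)`,
not all `a_i = 0`; since `x ∈ P` and `g_i(x) ∈ 𝒪_P`, applying the residue class map gives
`0 = ∑ a_i z_i(P)`, a contradiction. For a *global* function field the constant field `K = 𝔽_q`
is finite, so `F_P`, a finite-dimensional `𝔽_q`-space, is a finite set — the vendored fact.

## The Lean proof

Same argument, organised so that only `[F : 𝔽_q(T)] < ∞` (the `FunctionField Fq F` instance) is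
needed rather than `[F : K(x)] < ∞` for an arbitrary `x ∈ P`:

* `Place.finite_residueField_core` — the linear-algebra core, abstracted from the function field:
  `O` a valuation subring of a field `F`, `ψ : k[X] →+* F` (`k` finite) with image in `O` and some
  `ψ c ≠ 0` in the maximal ideal, and every family of more than `N` elements of `O` admitting a
  non-trivial `ψ(k[X])`-linear relation. Then `p := ker (k[X] → O → O/m)` is a nonzero prime,
  `k[X]/p` is a finite field (`AdjoinRoot.powerBasis`), and `O/m` is a `k[X]/p`-space in which
  `> N` elements are always dependent: gcd-normalise a relation (`Finset.extract_gcd`) so that not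
  all coefficients lie in `p = (π)` — this is Stichtenoth's "not all `φ_i` divisible by `x`", with
  `x` replaced by the generator `π` — and reduce modulo `m`.
* `Place.finite_residueField_holds` — for a place `v = (O, …)` of `F / 𝔽_q(T)`: constants lie in
  `O` (`a^(q-1) = 1`); `𝔽_q(T)`-dependence of `> [F : 𝔽_q(T)]` elements gives `𝔽_q[T]`-relations
  after clearing denominators (`IsLocalization.exist_integer_multiples_of_finite`). If `T ∈ O`
  take `ψ = (𝔽_q[X] → F)`; some nonzero polynomial in `T` lies in `m`, for otherwise
  `𝔽_q(T) ⊆ O` and integrality of `F/𝔽_q(T)` would force `O = F` (`IsIntegrallyClosed O`). If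
  `T ∉ O` then `T⁻¹ ∈ m`; take `ψ =` evaluation at `T⁻¹` and transport the `𝔽_q[T]`-relations to
  `𝔽_q[T⁻¹]`-relations with `Polynomial.reflect` (`eval₂_reflect_mul_pow`). These two cases are the
  places `P_{p(x)}` and `P_∞` of `𝔽_q(T)` below `v` (Stichtenoth Thm. 1.2.2).

An independent formalisation of the same finiteness for an arbitrary valuation subring `O ≠ ⊤`
of `F` (Rosen's rendering, GTM 210, Ch. 5, p. 46, with the auxiliary element taken in `𝔽_q(T)`)
is `Literature.NumberTheory.EllipticCurves.FunctionField.finite_residueField_valuationSubring_of_ne_top` in the sibling file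
`FunctionFieldPlacesResidueField.lean` (discharge of `Place.one_lt_residueCard`); the present file
does not depend on it.

## On the statement of `Place.finite_residueField` (binders)

The fact was written in `FunctionFieldPlaces.lean` under
`variable (Fq) [Field Fq] [Fintype Fq] {F} [Field F] [Algebra Fq[X] F] [Algebra (RatFunc Fq) F]
[IsScalarTower Fq[X] (RatFunc Fq) F] [FunctionField Fq F]` with `include Fq`, but it is a
`def … : Prop` whose body mentions only `F`, and a `def` abstracts only the section variables its
body uses (`include` governs theorems). It therefore elaborates as
`Place.finite_residueField : {F : Type} → [Field F] → Prop`, the predicate "every place of `F` has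
finite residue field" on a bare field `F` — true for global function fields (this file), false in
general (`Place.not_finite_residueField` in `FunctionFieldPlacesProofs.lean`: `Frac ℚ⟦X⟧` has a
place with residue field `⊇ ℚ`). Accordingly the discharge carries the global-function-field
instance stack (exactly the one displayed above) as hypotheses and proves
`finite_residueField (F := F)`; a consumer `(h : Place.finite_residueField (F := F))` working over
`[FunctionField Fq F]` is fed `Place.finite_residueField_holds Fq` (see the `example`s at the end).
The `def` itself is untouched.

## References

* H. Stichtenoth, *Algebraic Function Fields and Codes*, GTM 254, Springer 2009, §1.1:
  Remark 1.1.2, Def. 1.1.14, Prop. 1.1.15; §1.2, Thm. 1.2.2. doi:10.1007/978-3-540-76878-4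
  [Stichtenoth2009]
* M. Rosen, *Number Theory in Function Fields*, GTM 210, Springer 2002, Ch. 5, p. 46.
  [RosenFunctionFields2002]
-/

noncomputable section

open scoped Classical Polynomial

namespace Literature.NumberTheory.EllipticCurves.FunctionField

namespace Place

/-- **The linear-algebra core of Stichtenoth's proof of Prop. I.1.15**, abstracted from the
function field. Let `O` be a valuation subring of a field `F` and `ψ : k[X] →+* F` (`k` a finite
field) a ring map with image in `O` such that some `ψ c ≠ 0` lies in the maximal ideal of `O`, and
suppose every family of more than `N` elements of `O` admits a non-trivial `ψ(k[X])`-linear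
relation. Then the residue field of `O` is finite: with `p = ker (k[X] → O → O/m) ≠ ⊥`, `O/m` is a
vector space over the finite field `k[X]/p` in which every linearly independent finite set has at
most `N` elements (gcd-normalise a relation so that not all coefficients lie in `p = (π)` —
Stichtenoth's "w.l.o.g. not all `φ_i(x)` are divisible by `x`" — then apply the residue map).
[cite: Stichtenoth2009, Prop. 1.1.15 (proof, §1.1)] -/
theorem finite_residueField_core {k F : Type} [Field k] [Finite k] [Field F]
    (O : ValuationSubring F) (ψ : k[X] →+* F) (hψ : ∀ c, ψ c ∈ O) (N : ℕ)
    (hp : ∃ c : k[X], ψ c ≠ 0 ∧ O.valuation (ψ c) < 1)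
    (hdep : ∀ (ι : Type) [Fintype ι], N < Fintype.card ι → ∀ x : ι → F, (∀ i, x i ∈ O) →
      ∃ c : ι → k[X], ∑ i, ψ (c i) * x i = 0 ∧ ∃ i, ψ (c i) ≠ 0) :
    Finite (IsLocalRing.ResidueField O) := by
  classical
  let ψ' : k[X] →+* O := ψ.codRestrict O hψ
  let φ : k[X] →+* IsLocalRing.ResidueField O := (IsLocalRing.residue O).comp ψ'
  let p : Ideal k[X] := RingHom.ker φ
  have hp0 : p ≠ ⊥ := by
    obtain ⟨c, hc0, hc1⟩ := hp
    intro h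
    have hc : c ∈ p := by
      rw [RingHom.mem_ker, RingHom.comp_apply, IsLocalRing.residue_eq_zero_iff,
        ValuationSubring.valuation_lt_one_iff]
      exact hc1
    rw [h, Ideal.mem_bot] at hc
    exact hc0 (by rw [hc, map_zero])
  haveI hprime : p.IsPrime := RingHom.ker_isPrime φ
  haveI : p.IsMaximal := IsPrime.to_maximal_ideal hp0
  letI : Field (k[X] ⧸ p) := Ideal.Quotient.field p
  let π : k[X] := Submodule.IsPrincipal.generator p
  have hπp : Ideal.span {π} = p := Ideal.span_singleton_generator p
  have hπ0 : π ≠ 0 := fun h =>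
    hp0 ((Submodule.IsPrincipal.eq_bot_iff_generator_eq_zero p).mpr h)
  haveI : Finite (k[X] ⧸ p) := by
    haveI : Module.Finite k (AdjoinRoot π) := (AdjoinRoot.powerBasis hπ0).finite
    haveI : Finite (AdjoinRoot π) := Module.finite_of_finite k
    exact Finite.of_equiv (AdjoinRoot π) (Ideal.quotEquivOfEq hπp).toEquiv
  letI alg : Algebra (k[X] ⧸ p) (IsLocalRing.ResidueField O) :=
    (Ideal.Quotient.lift p φ fun a ha => ha).toAlgebra
  have halg : ∀ a : k[X],
      algebraMap (k[X] ⧸ p) (IsLocalRing.ResidueField O) (Ideal.Quotient.mk p a) = φ a :=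
    fun a => rfl
  haveI : Module.Finite (k[X] ⧸ p) (IsLocalRing.ResidueField O) := by
    refine Module.rank_lt_aleph0_iff.mp
      (lt_of_le_of_lt (rank_le (n := N) ?_) (Cardinal.natCast_lt_aleph0 (n := N)))
    intro s hs
    by_contra hlt
    push Not at hlt
    obtain ⟨x, hx⟩ : ∃ x : s → O, ∀ i, IsLocalRing.residue O (x i) = i :=
      ⟨fun i => (Ideal.Quotient.mk_surjective (i : IsLocalRing.ResidueField O)).choose,
       fun i => (Ideal.Quotient.mk_surjective (i : IsLocalRing.ResidueField O)).choose_spec⟩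
    obtain ⟨c, hc, j, hj⟩ :=
      hdep s (by simpa using hlt) (fun i => (x i : F)) (fun i => (x i).2)
    haveI : Nonempty s := ⟨j⟩
    obtain ⟨d, hd, hgcd⟩ := Finset.extract_gcd c (Finset.univ_nonempty (α := s))
    have hG : ψ ((Finset.univ : Finset s).gcd c) ≠ 0 := by
      intro h0
      apply hj
      rw [hd j (Finset.mem_univ j), map_mul, h0, zero_mul]
    have hrel : ∑ i, ψ (d i) * (x i : F) = 0 := by
      have : ψ ((Finset.univ : Finset s).gcd c) * ∑ i, ψ (d i) * (x i : F) = 0 := by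
        rw [Finset.mul_sum, ← hc]
        refine Finset.sum_congr rfl fun i _ => ?_
        rw [hd i (Finset.mem_univ i), map_mul, mul_assoc]
      exact (mul_eq_zero.mp this).resolve_left hG
    have hrelO : ∑ i, ψ' (d i) * x i = 0 := by
      apply Subtype.val_injective
      simp only [AddSubmonoidClass.coe_finsetSum, MulMemClass.coe_mul, ZeroMemClass.coe_zero]
      exact hrel
    have hrelκ : ∑ i, (Ideal.Quotient.mk p (d i)) • (i : IsLocalRing.ResidueField O) = 0 := by
      have := congrArg (IsLocalRing.residue O) hrelO
      rw [map_sum, map_zero] at this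
      simp only [map_mul, hx] at this
      simp only [Algebra.smul_def, halg]
      exact this
    have hdp : ∀ i, d i ∈ p := fun i =>
      Ideal.Quotient.eq_zero_iff_mem.mp (Fintype.linearIndependent_iff.mp hs _ hrelκ i)
    have hπd : π ∣ (Finset.univ : Finset s).gcd d :=
      Finset.dvd_gcd fun i _ => (Submodule.IsPrincipal.mem_iff_generator_dvd p).mp (hdp i)
    rw [hgcd] at hπd
    exact hprime.ne_top (Ideal.eq_top_of_isUnit_mem p (Submodule.IsPrincipal.generator_mem p)
      (isUnit_of_dvd_one hπd))
  exact Module.finite_of_finite (k[X] ⧸ p)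

section FunctionField

variable (Fq : Type) [Field Fq] [Fintype Fq] {F : Type} [Field F]
variable [Algebra Fq[X] F] [Algebra (RatFunc Fq) F] [IsScalarTower Fq[X] (RatFunc Fq) F]
variable [FunctionField Fq F]

include Fq in
/-- **Stichtenoth Prop. I.1.15 for global function fields — discharge of the named fact
`Place.finite_residueField`.** If `Fq` is a finite field and `F` a finite extension of `𝔽_q(T)`
(the instance stack `[Algebra Fq[X] F] [Algebra (RatFunc Fq) F] [IsScalarTower Fq[X] (RatFunc Fq) F]
[FunctionField Fq F]` of `FunctionFieldPlaces.lean`), then the residue field `O_v/m_v` of every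
place `v` of `F` is finite ("`deg P ≤ [F : K(x)] < ∞` for `0 ≠ x ∈ P`", with `K = 𝔽_q` finite).
The fact `finite_residueField` elaborates as a predicate on the bare field `F` (its function-field
binders are not part of the `def`, see the module docstring), so this theorem carries them and
proves `finite_residueField (F := F)`; feed `finite_residueField_holds Fq` to consumers of
`(h : finite_residueField (F := F))`.
Proof: with `T` the image of `X`, either `T ∈ O_v` (then `𝔽_q[T] ⊆ O_v`, and `𝔽_q[T] ∩ m_v ≠ 0`
since otherwise `𝔽_q(T) ⊆ O_v` and integrality of `F / 𝔽_q(T)` would force `O_v = F`) or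
`T⁻¹ ∈ m_v` (then `𝔽_q[T⁻¹] ⊆ O_v`, and `𝔽_q[T]`-relations become `𝔽_q[T⁻¹]`-relations via
`Polynomial.reflect`); in both cases `finite_residueField_core` applies with `N = [F : 𝔽_q(T)]`
(any `N + 1` elements of `F` are `𝔽_q(T)`-linearly dependent; clear denominators).
[cite: Stichtenoth2009, Prop. 1.1.15 (§1.1: deg P ≤ [F:K(x)] < ∞)] -/
theorem finite_residueField_holds : finite_residueField (F := F) := by
  classical
  rintro ⟨O, hOtop, hDVR⟩
  show Finite (IsLocalRing.ResidueField O)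
  let K := RatFunc Fq
  let f : Fq[X] →+* F := algebraMap Fq[X] F
  have hfK : ∀ c, f c = algebraMap K F (algebraMap Fq[X] K c) :=
    fun c => IsScalarTower.algebraMap_apply Fq[X] K F c
  have hf : Function.Injective f := by
    intro a b h
    rw [hfK, hfK] at h
    exact IsFractionRing.injective Fq[X] K ((algebraMap K F).injective h)
  let T : F := f Polynomial.X
  let N : ℕ := Module.finrank K F
  -- constants of `𝔽_q` lie in every valuation ring (they are roots of unity or zero)
  have hC : ∀ a : Fq, f (Polynomial.C a) ∈ O := by
    intro a
    by_cases ha : a = 0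
    · rw [ha, map_zero, map_zero]; exact zero_mem O
    have hq : Fintype.card Fq - 1 ≠ 0 := by
      have := Fintype.one_lt_card (α := Fq); omega
    have h1 : f (Polynomial.C a) ^ (Fintype.card Fq - 1) = 1 := by
      rw [← map_pow, ← map_pow, FiniteField.pow_card_sub_one_eq_one a ha, map_one, map_one]
    rw [← O.valuation_le_one_iff, ← pow_le_one_iff hq, ← map_pow, h1, map_one]
  -- the image of `K = 𝔽_q(T)`-linear dependence, with denominators cleared
  have hrel : ∀ (ι : Type) [Fintype ι], N < Fintype.card ι → ∀ x : ι → F,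
      ∃ c : ι → Fq[X], ∑ i, f (c i) * x i = 0 ∧ ∃ i, f (c i) ≠ 0 := by
    intro ι _ hι x
    have hli : ¬ LinearIndependent K x := fun h => Nat.not_lt.mpr h.fintype_card_le_finrank hι
    obtain ⟨a, ha, j, hj⟩ := Fintype.not_linearIndependent_iff.mp hli
    obtain ⟨b, hb⟩ :=
      IsLocalization.exist_integer_multiples_of_finite (nonZeroDivisors Fq[X]) a
    choose c hc using fun i => RingHom.mem_rangeS.mp (hb i)
    refine ⟨c, ?_, j, ?_⟩
    · have : ∀ i, f (c i) * x i = algebraMap K F (algebraMap Fq[X] K b) * (a i • x i) := by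
        intro i
        rw [hfK, hc i, Algebra.smul_def, map_mul, Algebra.smul_def, mul_assoc]
      simp_rw [this, ← Finset.mul_sum, ha, mul_zero]
    · rw [hfK, hc j, Algebra.smul_def, map_mul]
      exact mul_ne_zero ((map_ne_zero _).mpr
        (IsFractionRing.to_map_ne_zero_of_mem_nonZeroDivisors b.2)) ((map_ne_zero _).mpr hj)
  -- evaluation of a polynomial at `T` is `f`
  have hfe : ∀ c : Fq[X], Polynomial.eval₂ (f.comp Polynomial.C) T c = f c := fun c => by
    conv_rhs => rw [← Polynomial.eval₂_C_X (p := c)]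
    exact (Polynomial.hom_eval₂ c Polynomial.C f Polynomial.X).symm
  by_cases hT : T ∈ O
  · -- Case 1: `T ∈ O`, so `𝔽_q[T] ⊆ O`.
    have hmem : ∀ c : Fq[X], f c ∈ O := by
      intro c
      induction c using Polynomial.induction_on with
      | C a => exact hC a
      | add p q hp hq => rw [map_add]; exact add_mem hp hq
      | monomial n a h => rw [pow_succ, ← mul_assoc, map_mul]; exact mul_mem h hT
    refine finite_residueField_core O f hmem N ?_ ?_
    · -- some nonzero polynomial in `T` lies in the maximal ideal, since `O ≠ F`
      by_contra hcon
      push Not at hcon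
      apply hOtop
      have hK : ∀ a : K, algebraMap K F a ∈ O := by
        intro a
        rw [← RatFunc.num_div_denom a, map_div₀, ← hfK, ← hfK, ← O.valuation_le_one_iff,
          map_div₀]
        have hden : O.valuation (f a.denom) = 1 :=
          le_antisymm ((O.valuation_le_one_iff _).mpr (hmem _))
            (hcon _ ((map_ne_zero_iff f hf).mpr (RatFunc.denom_ne_zero a)))
        rw [hden, div_one]
        exact (O.valuation_le_one_iff _).mpr (hmem _)
      refine ValuationSubring.ext _ _ fun y => ⟨fun _ => ValuationSubring.mem_top y, fun _ => ?_⟩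
      letI : Algebra K O := ((algebraMap K F).codRestrict O hK).toAlgebra
      haveI : IsScalarTower K O F := IsScalarTower.of_algebraMap_eq (fun _ => rfl)
      have hy : IsIntegral O y := (Algebra.IsIntegral.isIntegral (R := K) y).tower_top
      obtain ⟨z, hz⟩ := (IsIntegrallyClosed.isIntegral_iff (R := O) (K := F)).mp hy
      rw [← hz]
      exact z.2
    · intro ι _ hι x hx
      exact hrel ι hι x
  · -- Case 2: `T ∉ O`, so `T⁻¹` lies in the maximal ideal and `𝔽_q[T⁻¹] ⊆ O`.
    have hT0 : T ≠ 0 := fun h => hT (h ▸ zero_mem O)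
    have hTi : T⁻¹ ∈ O := (O.mem_or_inv_mem T).resolve_left hT
    let ψ : Fq[X] →+* F := Polynomial.eval₂RingHom (f.comp Polynomial.C) T⁻¹
    have hψX : ψ Polynomial.X = T⁻¹ := Polynomial.eval₂_X _ _
    have hmem : ∀ c : Fq[X], ψ c ∈ O := by
      intro c
      induction c using Polynomial.induction_on with
      | C a => show Polynomial.eval₂ _ _ _ ∈ O; rw [Polynomial.eval₂_C]; exact hC a
      | add p q hp hq => rw [map_add]; exact add_mem hp hq
      | monomial n a h => rw [pow_succ, ← mul_assoc, map_mul, hψX]; exact mul_mem h hTi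
    refine finite_residueField_core O ψ hmem N ⟨Polynomial.X, ?_, ?_⟩ ?_
    · rw [hψX]; exact inv_ne_zero hT0
    · rw [hψX, ← Valuation.one_lt_val_iff _ hT0]
      exact lt_of_not_ge fun h => hT ((O.valuation_le_one_iff T).mp h)
    · intro ι _ hι x hx
      obtain ⟨c, hc, j, hj⟩ := hrel ι hι x
      let D : ℕ := Finset.univ.sup fun i => (c i).natDegree
      letI : Invertible T := invertibleOfNonzero hT0
      have key : ∀ i, ψ (Polynomial.reflect D (c i)) * T ^ D = f (c i) := by
        intro i
        have := Polynomial.eval₂_reflect_mul_pow (f.comp Polynomial.C) T D (c i)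
          (Finset.le_sup (f := fun i => (c i).natDegree) (Finset.mem_univ i))
        rw [invOf_eq_inv, hfe] at this
        exact this
      refine ⟨fun i => Polynomial.reflect D (c i), ?_, j, ?_⟩
      · have : (∑ i, ψ (Polynomial.reflect D (c i)) * x i) * T ^ D = 0 := by
          rw [Finset.sum_mul, ← hc]
          refine Finset.sum_congr rfl fun i _ => ?_
          rw [mul_right_comm, key]
        exact (mul_eq_zero.mp this).resolve_right (pow_ne_zero D hT0)
      · intro h0
        apply hj
        rw [← key, h0, zero_mul]

end FunctionField

/- Sanity check: the discharge is stated over exactly the instance stack under which the fact was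
written in `FunctionFieldPlaces.lean`, so it feeds a consumer hypothesis
`(h : finite_residueField (F := F))` directly. -/
example (Fq : Type) [Field Fq] [Fintype Fq] (F : Type) [Field F] [Algebra Fq[X] F]
    [Algebra (RatFunc Fq) F] [IsScalarTower Fq[X] (RatFunc Fq) F] [FunctionField Fq F] :
    finite_residueField (F := F) :=
  finite_residueField_holds Fq

/- Sanity check: the pointwise form a consumer typically needs — a `Finite` instance on the
residue field of a given place. -/
example (Fq : Type) [Field Fq] [Fintype Fq] (F : Type) [Field F] [Algebra Fq[X] F]
    [Algebra (RatFunc Fq) F] [IsScalarTower Fq[X] (RatFunc Fq) F] [FunctionField Fq F]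
    (v : Place F) : Finite (IsLocalRing.ResidueField v.1) :=
  finite_residueField_holds Fq v

end Place

end Literature.NumberTheory.EllipticCurves.FunctionField
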